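import Literature.MathematicalPhysics.QuantumManyBody.PeriodicSlotDepletion
import Literature.MathematicalPhysics.QuantumManyBody.TorusSlotShiftDirichlet
import HarnessLib
-- module: Summits.AtomisticToContinuum.BoseEinsteinCondensation.Theorems.BECRewardDescentRewardChordBoundSlotAverage

/-!
# The one-slot average of an `L²` class on `(ℝ/ℤ)^{N×3}` (crux `RewardChordBound`, stmt-AtomisticToContinuum-12876,
# stub R2 `stub_teleportPackage`, helper file 1: the reward kernel moves one particle anywhere)

For `η ∈ L²((ℝ/ℤ)^{N×3})` (Haar probability measure) and a slot (particle) `i`, the **slot average**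
`(Pᵢη)(t) = ∫ η(t + σᵢ c) dc` over the one-slot shifts `σᵢ c = slotShift i c`, `c ∈ (ℝ/ℤ)³`, is the
orthogonal projection onto the classes not depending on slot `i`; in the spectral vocabulary of
`PeriodicSlotDepletion.lean` it is `η - exciteProj N i η` (`exciteProj` projects onto the modes with `n(i,·) ≠ 0`).
The reward `-s n̂₀ = -s ∑ᵢ Pᵢ` of the route's rewarded Bose gas therefore has the NON-NEGATIVE KERNEL "move particle
`i` anywhere in the cell", which is the irreducibility mechanism of the lead's teleport argument. This file proves:

* `lintegral_comp_add_slotShift` — `∫∫ f(t + σᵢc) dt dc = ∫ f` (Tonelli and translation invariance), and the null-set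
  pull-back `measure_preimage_add_slotShift_eq_zero`;
* `(∫ c : T3, (η : TN N → ℂ) (t + slotShift i c)) = ∫ η(t + σᵢ c) dc` is a.e. strongly measurable and square integrable (Jensen), with Fourier
  coefficients `𝟙[n(i,·) = 0] η̂(n)` (Fubini, `mFourierCoeff_comp_add_right`, `mFourier_slotShift`,
  `integral_mFourier_eq_ite`), hence `coeFn_sub_exciteProj_ae_eq_slotAvg`: `η - exciteProj N i η = Pᵢη` a.e.;
* for a non-negative class (`|η| = η`): `Pᵢη ≥ 0` a.e. (`slotAvg_eq_ofReal_of_absLp_eq`) and, at a.e. `t`,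
  `(Pᵢη)(t) = 0` forces `η(t + σᵢ c) = 0` for a.e. `c` (`ae_slotAvg_eq_zero_imp`).

References: M. Reed, B. Simon, *Methods of Modern Mathematical Physics IV* (1978), §XIII.12 (positivity improving
kernels); folklore Fourier analysis on the torus.
-/

noncomputable section

open MeasureTheory Filter Set Complex UnitAddTorus
open scoped ENNReal NNReal Topology InnerProductSpace ComplexConjugate
open Literature.Analysis.FunctionSpaces Literature.Analysis.OperatorTheory Literature.Analysis.InnerProduct

namespace Summit.AtomisticToContinuum.BoseEinsteinCondensation.Cruxes.RewardChordBound.Birth.SlotAverage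

open Literature.MathematicalPhysics.QuantumManyBody.BoseGas

-- The measure on `ℝ/ℤ` is the Haar PROBABILITY measure, as in `PeriodicFormDomain.lean`.
attribute [local instance] Literature.MathematicalPhysics.QuantumManyBody.BoseGas.formDomain_measureSpace
  Literature.MathematicalPhysics.QuantumManyBody.BoseGas.formDomain_isProbabilityMeasure
  Literature.MathematicalPhysics.QuantumManyBody.BoseGas.formDomain_isProbabilityMeasure_pi

variable {N : ℕ}

/-- Local notation for the Hilbert space `L²((ℝ/ℤ)^{3N})`, as in `PeriodicFormDomain.lean`. -/
local notation "L2T " N':max => Lp ℂ 2 (volume : Measure (UnitAddTorus (Fin N' × Fin 3)))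

/-- Local notation for the configuration torus `(ℝ/ℤ)^{N×3}`. -/
local notation "TN " N':max => UnitAddTorus (Fin N' × Fin 3)

/-- Local notation for the one-particle torus `(ℝ/ℤ)³`. -/
local notation "T3" => UnitAddTorus (Fin 3)

-- Translation invariance of the Haar product measure (closed local-instance defs of the tree).
attribute [local instance] Literature.MathematicalPhysics.QuantumManyBody.BoseGas.slotShift_isAddRightInvariant

/-! ### The shear `(t, c) ↦ t + σᵢ c` -/

/-- The shear `(t, c) ↦ t + σᵢ c` is measurable. [folklore] -/
theorem measurable_add_slotShift (i : Fin N) :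
    Measurable fun p : TN N × T3 => p.1 + slotShift i p.2 :=
  measurable_fst.add ((measurable_slotShift i).comp measurable_snd)

/-- **Tonelli through the shear**: `∫⁻∫⁻ f(t + σᵢ c) = ∫⁻ f` for measurable `f ≥ 0` (integrate `t` first: the
Haar measure is translation invariant; the `c`-integral of a constant over a probability space is the constant).
[folklore] -/
theorem lintegral_comp_add_slotShift (i : Fin N) {f : TN N → ℝ≥0∞} (hf : Measurable f) :
    ∫⁻ p : TN N × T3, f (p.1 + slotShift i p.2) = ∫⁻ t, f t := by
  rw [Measure.volume_eq_prod, lintegral_prod_symm (fun p : TN N × T3 => f (p.1 + slotShift i p.2))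
    (hf.comp (measurable_add_slotShift i)).aemeasurable]
  have h : ∀ c : T3, ∫⁻ t : TN N, f (t + slotShift i c) = ∫⁻ t, f t := fun c =>
    lintegral_add_right_eq_self f (slotShift i c)
  simp only [h, lintegral_const, measure_univ, mul_one]

/-- **Null sets pull back through the shear**: if `S` is null then `{(t, c) | t + σᵢ c ∈ S}` is null. [folklore] -/
theorem measure_preimage_add_slotShift_eq_zero (i : Fin N) {S : Set (TN N)} (hS : MeasurableSet S)
    (h0 : volume S = 0) : volume {p : TN N × T3 | p.1 + slotShift i p.2 ∈ S} = 0 := by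
  have hset : MeasurableSet {p : TN N × T3 | p.1 + slotShift i p.2 ∈ S} := hS.preimage (measurable_add_slotShift i)
  have h := lintegral_comp_add_slotShift i ((@measurable_one ℝ≥0∞ (TN N) _ _ _).indicator hS)
  rw [lintegral_indicator_one hS, h0] at h
  rw [← lintegral_indicator_one hset, ← h]
  refine lintegral_congr fun p => ?_
  simp only [Set.indicator, Set.mem_setOf_eq, Pi.one_apply]
  split_ifs <;> rfl

/-- A.e. statements pull back through the shear: if `P` holds a.e. then `P (t + σᵢ c)` holds for a.e. `(t, c)`.
[folklore] -/
theorem ae_prod_comp_add_slotShift (i : Fin N) {P : TN N → Prop} (hP : MeasurableSet {t | P t})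
    (h : ∀ᵐ t, P t) : ∀ᵐ p : TN N × T3, P (p.1 + slotShift i p.2) := by
  rw [ae_iff] at h ⊢
  exact measure_preimage_add_slotShift_eq_zero i hP.compl h

/-! ### The slot average -/

/-! The **slot average** of the canonical representative of `η ∈ L²` is written throughout as the explicit
parametric integral `fun t => ∫ c, η (t + slotShift i c)` (`(Pᵢη)(t) = ∫ η(t + σᵢ c) dc`). -/

/-- The shifted representative `(t, c) ↦ η(t + σᵢ c)` is measurable. [folklore] -/
theorem measurable_comp_add_slotShift (i : Fin N) (η : L2T N) :
    Measurable fun p : TN N × T3 => (η : TN N → ℂ) (p.1 + slotShift i p.2) :=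
  (Lp.stronglyMeasurable η).measurable.comp (measurable_add_slotShift i)

/-- `∫⁻∫⁻ |η(t + σᵢ c)|² = ‖η‖²` (as `∫⁻ ‖η‖ₑ²`). [folklore] -/
theorem lintegral_enorm_comp_add_slotShift_sq (i : Fin N) (η : L2T N) :
    ∫⁻ p : TN N × T3, ‖(η : TN N → ℂ) (p.1 + slotShift i p.2)‖ₑ ^ 2 = ∫⁻ t, ‖(η : TN N → ℂ) t‖ₑ ^ 2 :=
  lintegral_comp_add_slotShift i (f := fun t => ‖(η : TN N → ℂ) t‖ₑ ^ 2)
    ((Lp.stronglyMeasurable η).measurable.enorm.pow_const 2)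

/-- `∫⁻ ‖η‖ₑ² < ⊤` for `η ∈ L²`. [folklore] -/
theorem lintegral_enorm_sq_lt_top (η : L2T N) : ∫⁻ t, ‖(η : TN N → ℂ) t‖ₑ ^ 2 < ⊤ := by
  have h := lintegral_rpow_enorm_lt_top_of_eLpNorm_lt_top two_ne_zero ENNReal.ofNat_ne_top (Lp.memLp η).eLpNorm_lt_top
  simp only [ENNReal.toReal_ofNat] at h
  have h2 : ∫⁻ t, ‖(η : TN N → ℂ) t‖ₑ ^ 2 = ∫⁻ t, ‖(η : TN N → ℂ) t‖ₑ ^ (2 : ℝ) :=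
    lintegral_congr fun t => by rw [← ENNReal.rpow_natCast]; norm_num
  rw [h2]
  exact h

/-- The shifted representative is square integrable on the product. [folklore] -/
theorem memLp_two_comp_add_slotShift (i : Fin N) (η : L2T N) :
    MemLp (fun p : TN N × T3 => (η : TN N → ℂ) (p.1 + slotShift i p.2)) 2 (volume : Measure (TN N × T3)) := by
  refine ⟨(measurable_comp_add_slotShift i η).aestronglyMeasurable, ?_⟩
  rw [eLpNorm_eq_lintegral_rpow_enorm_toReal two_ne_zero ENNReal.ofNat_ne_top]
  simp only [ENNReal.toReal_ofNat, one_div]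
  refine ENNReal.rpow_lt_top_of_nonneg (by norm_num) (ne_of_lt ?_)
  have h := lintegral_enorm_comp_add_slotShift_sq i η
  have h2 : ∫⁻ p : TN N × T3, ‖(η : TN N → ℂ) (p.1 + slotShift i p.2)‖ₑ ^ (2 : ℝ) =
      ∫⁻ p : TN N × T3, ‖(η : TN N → ℂ) (p.1 + slotShift i p.2)‖ₑ ^ 2 :=
    lintegral_congr fun p => by rw [← ENNReal.rpow_natCast]; norm_num
  rw [h2, h]
  exact lintegral_enorm_sq_lt_top η

/-- The shifted representative is integrable on the product (probability space). [folklore] -/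
theorem integrable_comp_add_slotShift (i : Fin N) (η : L2T N) :
    Integrable (fun p : TN N × T3 => (η : TN N → ℂ) (p.1 + slotShift i p.2)) (volume : Measure (TN N × T3)) :=
  (memLp_two_comp_add_slotShift i η).integrable one_le_two

/-- The slot average is a.e. strongly measurable. [folklore] -/
theorem aestronglyMeasurable_slotAvg (i : Fin N) (η : L2T N) :
    AEStronglyMeasurable ((fun t : TN N => ∫ c : T3, (η : TN N → ℂ) (t + slotShift i c))) volume :=
  (integrable_comp_add_slotShift i η).aestronglyMeasurable.integral_prod_right'

/-- **Jensen for the slot average**: `‖(Pᵢη)(t)‖ₑ² ≤ ∫⁻ ‖η(t + σᵢ c)‖ₑ² dc` for every `t`. [folklore] -/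
theorem enorm_slotAvg_sq_le (i : Fin N) (η : L2T N) (t : TN N) :
    ‖(∫ c : T3, (η : TN N → ℂ) (t + slotShift i c))‖ₑ ^ 2 ≤ ∫⁻ c : T3, ‖(η : TN N → ℂ) (t + slotShift i c)‖ₑ ^ 2 := by
  have hmeas : AEMeasurable (fun c : T3 => ‖(η : TN N → ℂ) (t + slotShift i c)‖ₑ) volume :=
    ((Lp.stronglyMeasurable η).measurable.comp
      (measurable_const.add (measurable_slotShift i))).enorm.aemeasurable
  -- `‖∫ F‖ₑ ≤ ∫⁻ ‖F‖ₑ ≤ (∫⁻ ‖F‖ₑ²)^{1/2}` (Hölder with the constant `1` on a probability space)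
  have h1 : ‖(∫ c : T3, (η : TN N → ℂ) (t + slotShift i c))‖ₑ ≤ ∫⁻ c : T3, ‖(η : TN N → ℂ) (t + slotShift i c)‖ₑ :=
    enorm_integral_le_lintegral_enorm _
  have h2 : ∫⁻ c : T3, ‖(η : TN N → ℂ) (t + slotShift i c)‖ₑ ≤
      (∫⁻ c : T3, ‖(η : TN N → ℂ) (t + slotShift i c)‖ₑ ^ (2 : ℝ)) ^ (1 / (2 : ℝ)) := by
    have h := ENNReal.lintegral_mul_le_Lp_mul_Lq volume (Real.HolderConjugate.two_two) hmeas
      (g := fun _ => 1) aemeasurable_const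
    simp only [mul_one, ENNReal.one_rpow, lintegral_const, measure_univ] at h
    simpa using h
  have h3 : ‖(∫ c : T3, (η : TN N → ℂ) (t + slotShift i c))‖ₑ ^ (2 : ℝ) ≤ ∫⁻ c : T3, ‖(η : TN N → ℂ) (t + slotShift i c)‖ₑ ^ (2 : ℝ) := by
    have h := ENNReal.rpow_le_rpow (h1.trans h2) (show (0 : ℝ) ≤ 2 by norm_num)
    rwa [← ENNReal.rpow_mul, show (1 / (2 : ℝ)) * 2 = 1 by norm_num, ENNReal.rpow_one] at h
  have hl : ‖(∫ c : T3, (η : TN N → ℂ) (t + slotShift i c))‖ₑ ^ 2 = ‖(∫ c : T3, (η : TN N → ℂ) (t + slotShift i c))‖ₑ ^ (2 : ℝ) := by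
    rw [← ENNReal.rpow_natCast]; norm_num
  have hr : ∫⁻ c : T3, ‖(η : TN N → ℂ) (t + slotShift i c)‖ₑ ^ 2 =
      ∫⁻ c : T3, ‖(η : TN N → ℂ) (t + slotShift i c)‖ₑ ^ (2 : ℝ) :=
    lintegral_congr fun c => by rw [← ENNReal.rpow_natCast]; norm_num
  rw [hl, hr]
  exact h3

/-- **The slot average is square integrable**, `∫⁻ ‖Pᵢη‖ₑ² ≤ ∫⁻ ‖η‖ₑ²`. [folklore] -/
theorem lintegral_enorm_slotAvg_sq_le (i : Fin N) (η : L2T N) :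
    ∫⁻ t, ‖(∫ c : T3, (η : TN N → ℂ) (t + slotShift i c))‖ₑ ^ 2 ≤ ∫⁻ t, ‖(η : TN N → ℂ) t‖ₑ ^ 2 := by
  calc ∫⁻ t, ‖(∫ c : T3, (η : TN N → ℂ) (t + slotShift i c))‖ₑ ^ 2 ≤ ∫⁻ t, ∫⁻ c : T3, ‖(η : TN N → ℂ) (t + slotShift i c)‖ₑ ^ 2 :=
        lintegral_mono fun t => enorm_slotAvg_sq_le i η t
    _ = ∫⁻ p : TN N × T3, ‖(η : TN N → ℂ) (p.1 + slotShift i p.2)‖ₑ ^ 2 := by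
        rw [Measure.volume_eq_prod, lintegral_prod _ ((measurable_comp_add_slotShift i η).enorm.pow_const 2).aemeasurable]
    _ = ∫⁻ t, ‖(η : TN N → ℂ) t‖ₑ ^ 2 := lintegral_enorm_comp_add_slotShift_sq i η

/-- The slot average is in `L²`. [folklore] -/
theorem memLp_slotAvg (i : Fin N) (η : L2T N) : MemLp ((fun t : TN N => ∫ c : T3, (η : TN N → ℂ) (t + slotShift i c))) 2 volume := by
  refine ⟨aestronglyMeasurable_slotAvg i η, ?_⟩
  rw [eLpNorm_eq_lintegral_rpow_enorm_toReal two_ne_zero ENNReal.ofNat_ne_top]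
  simp only [ENNReal.toReal_ofNat, one_div]
  refine ENNReal.rpow_lt_top_of_nonneg (by norm_num) (ne_of_lt ?_)
  have h2 : ∫⁻ t, ‖(∫ c : T3, (η : TN N → ℂ) (t + slotShift i c))‖ₑ ^ (2 : ℝ) = ∫⁻ t, ‖(∫ c : T3, (η : TN N → ℂ) (t + slotShift i c))‖ₑ ^ 2 :=
    lintegral_congr fun p => by rw [← ENNReal.rpow_natCast]; norm_num
  rw [h2]
  exact (lintegral_enorm_slotAvg_sq_le i η).trans_lt (lintegral_enorm_sq_lt_top η)

/-- The representative of the `L²` class of the slot average is a.e. the slot average. [folklore] -/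
theorem coeFn_toLp_slotAvg (i : Fin N) (η : L2T N) :
    (((memLp_slotAvg i η).toLp _ : L2T N) : TN N → ℂ) =ᵐ[volume] (fun t : TN N => ∫ c : T3, (η : TN N → ℂ) (t + slotShift i c)) :=
  MemLp.coeFn_toLp _

/-! ### Fourier coefficients of the slot average and the identification `Pᵢη = η - exciteProj N i η` -/

/-- **Fourier coefficients of the slot average**: `𝓕(Pᵢη)(n) = 𝟙[n(i,·) = 0] η̂(n)` (Fubini through the shear,
translation property of the coefficients, `∫ e_m = 𝟙[m = 0]`). [folklore] -/
theorem mFourierCoeff_slotAvg (i : Fin N) (η : L2T N) (n : Fin N × Fin 3 → ℤ) :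
    mFourierCoeff ((fun t : TN N => ∫ c : T3, (η : TN N → ℂ) (t + slotShift i c))) n =
      (if (fun k => n (i, k)) = 0 then 1 else 0) * mFourierCoeff (η : TN N → ℂ) n := by
  -- Fubini for `(t, c) ↦ e_{-n}(t) η(t + σᵢ c)`
  have hint : Integrable (fun p : TN N × T3 => mFourier (-n) p.1 * (η : TN N → ℂ) (p.1 + slotShift i p.2))
      (volume : Measure (TN N × T3)) := by
    refine (integrable_comp_add_slotShift i η).bdd_mul (c := 1)
      ((map_continuous (mFourier (-n))).comp continuous_fst).aestronglyMeasurable (Eventually.of_forall fun p => ?_)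
    rw [Torus.norm_mFourier_apply]
  have hswap := integral_integral_swap (μ := (volume : Measure (TN N))) (ν := (volume : Measure T3))
    (f := fun t c => mFourier (-n) t * (η : TN N → ℂ) (t + slotShift i c)) (by rwa [Measure.volume_eq_prod] at hint)
  unfold mFourierCoeff
  simp only [smul_eq_mul]
  simp_rw [← integral_const_mul]
  rw [hswap]
  -- the inner integral is the coefficient of a translate
  have hinner : ∀ c : T3, ∫ t : TN N, mFourier (-n) t * (η : TN N → ℂ) (t + slotShift i c) =
      mFourier n (slotShift i c) * mFourierCoeff (η : TN N → ℂ) n := fun c => by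
    have h := mFourierCoeff_comp_add_right (η : TN N → ℂ) (slotShift i c) n
    unfold mFourierCoeff at h
    simp only [smul_eq_mul] at h
    exact h
  simp_rw [hinner, mFourier_slotShift]
  rw [integral_mul_const, integral_mFourier_eq_ite, integral_const_mul]
  simp only [mFourierCoeff, smul_eq_mul]

/-- **The slot average is the spectral projection onto the slot-`i`-independent modes**:
`η - exciteProj N i η = Pᵢη` in `L²`. [cite: ReedSimonIV1978, §XIII.12] -/
theorem sub_exciteProj_eq_toLp_slotAvg (i : Fin N) (η : L2T N) :
    η - exciteProj N i η = (memLp_slotAvg i η).toLp _ := by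
  refine Lp_eq_of_forall_inner_mFourierLp_eq fun n => ?_
  rw [inner_sub_right, inner_mFourierLp_exciteProj,
    HaarTorus.inner_mFourierLp_eq_mFourierCoeff ((memLp_slotAvg i η).toLp _ : L2T N) n,
    mFourierCoeff_congr_ae (coeFn_toLp_slotAvg i η) n, mFourierCoeff_slotAvg,
    ← HaarTorus.inner_mFourierLp_eq_mFourierCoeff]
  split_ifs <;> simp

/-- The representative of `η - exciteProj N i η` is a.e. the slot average `∫ η(· + σᵢ c) dc`. [folklore] -/
theorem coeFn_sub_exciteProj_ae_eq_slotAvg (i : Fin N) (η : L2T N) :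
    ((η - exciteProj N i η : L2T N) : TN N → ℂ) =ᵐ[volume] (fun t : TN N => ∫ c : T3, (η : TN N → ℂ) (t + slotShift i c)) := by
  rw [sub_exciteProj_eq_toLp_slotAvg]
  exact coeFn_toLp_slotAvg i η

/-! ### Non-negative classes -/

/-- The set where the representative is real non-negative is measurable. [folklore] -/
theorem measurableSet_eq_ofReal_norm (η : L2T N) :
    MeasurableSet {t : TN N | (η : TN N → ℂ) t = (((‖(η : TN N → ℂ) t‖ : ℝ) : ℂ))} :=
  measurableSet_eq_fun (Lp.stronglyMeasurable η).measurable
    (Complex.measurable_ofReal.comp (Lp.stronglyMeasurable η).measurable.norm)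

/-- For `|η| = η`, the shifted representatives are real non-negative for a.e. `(t, c)`, fibrewise. [folklore] -/
theorem ae_ae_comp_add_slotShift_eq_ofReal (i : Fin N) {η : L2T N} (habs : absLp η = η) :
    ∀ᵐ t : TN N, ∀ᵐ c : T3, (η : TN N → ℂ) (t + slotShift i c) =
      (((‖(η : TN N → ℂ) (t + slotShift i c)‖ : ℝ) : ℂ)) := by
  have hfr : ∀ᵐ t : TN N, (η : TN N → ℂ) t = (((‖(η : TN N → ℂ) t‖ : ℝ) : ℂ)) := by
    have h1 := coeFn_absLp η
    rw [habs] at h1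
    exact h1
  have h := ae_prod_comp_add_slotShift i (measurableSet_eq_ofReal_norm η) hfr
  rw [Measure.volume_eq_prod] at h
  exact Measure.ae_ae_of_ae_prod h

/-- **The slot average of a non-negative class is real non-negative**: for `|η| = η`,
`(Pᵢη)(t) = ∫ |η(t + σᵢ c)| dc` for a.e. `t`. [folklore] -/
theorem slotAvg_eq_ofReal_of_absLp_eq (i : Fin N) {η : L2T N} (habs : absLp η = η) :
    ∀ᵐ t : TN N, (∫ c : T3, (η : TN N → ℂ) (t + slotShift i c)) = (((∫ c : T3, ‖(η : TN N → ℂ) (t + slotShift i c)‖ : ℝ) : ℂ)) := by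
  filter_upwards [ae_ae_comp_add_slotShift_eq_ofReal i habs] with t ht
  rw [integral_congr_ae ht, integral_complex_ofReal]

/-- **A vanishing slot average of a non-negative class kills the whole fibre**: for `|η| = η`, at a.e. `t`,
`(Pᵢη)(t) = 0` implies `η(t + σᵢ c) = 0` for a.e. `c`. [folklore] -/
theorem ae_slotAvg_eq_zero_imp (i : Fin N) {η : L2T N} (habs : absLp η = η) :
    ∀ᵐ t : TN N, (∫ c : T3, (η : TN N → ℂ) (t + slotShift i c)) = 0 → ∀ᵐ c : T3, (η : TN N → ℂ) (t + slotShift i c) = 0 := by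
  have hint : ∀ᵐ t : TN N, Integrable (fun c : T3 => (η : TN N → ℂ) (t + slotShift i c)) volume := by
    have h := integrable_comp_add_slotShift i η
    rw [Measure.volume_eq_prod] at h
    exact h.prod_right_ae
  filter_upwards [ae_ae_comp_add_slotShift_eq_ofReal i habs, slotAvg_eq_ofReal_of_absLp_eq i habs, hint]
    with t ht hav hti h0
  rw [hav, Complex.ofReal_eq_zero] at h0
  have hnn : (0 : T3 → ℝ) ≤ᵐ[volume] fun c => ‖(η : TN N → ℂ) (t + slotShift i c)‖ :=
    Eventually.of_forall fun c => norm_nonneg _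
  have hz := (integral_eq_zero_iff_of_nonneg_ae hnn hti.norm).1 h0
  filter_upwards [hz] with c hc
  exact norm_eq_zero.1 hc

end Summit.AtomisticToContinuum.BoseEinsteinCondensation.Cruxes.RewardChordBound.Birth.SlotAverage

namespace Summit.AtomisticToContinuum.BoseEinsteinCondensation.Cruxes.RewardChordBound.Birth

open Summit.AtomisticToContinuum.BoseEinsteinCondensation.Cruxes.RewardChordBound.Birth.SlotAverage
  Literature.MathematicalPhysics.QuantumManyBody.BoseGas

/-- **Registered sub-goal of stub `stub_teleportPackage` (helper file 1, slot average): a vanishing spectral slot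
average of a non-negative class kills the one-particle fibre.** For `|η| = η` and a slot `i`, at a.e. `t` with
`(η - exciteProj N i η)(t) = 0`, `η(t + σᵢ c) = 0` for a.e. `c ∈ (ℝ/ℤ)³` (the `L²` space is written with the explicit
Haar product measure, definitionally the package's `L2T N`). [cite: ReedSimonIV1978, §XIII.12] -/
theorem stub_teleportPackage_SlotAverage :
    ∀ (N : ℕ) (i : Fin N) (η : MeasureTheory.Lp ℂ 2 (MeasureTheory.Measure.pi fun _ : Fin N × Fin 3 =>
        (AddCircle.haarAddCircle : MeasureTheory.Measure UnitAddCircle))),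
      Literature.MathematicalPhysics.QuantumManyBody.BoseGas.absLp η = η →
      ∀ᵐ t ∂(MeasureTheory.Measure.pi fun _ : Fin N × Fin 3 => (AddCircle.haarAddCircle : MeasureTheory.Measure UnitAddCircle)),
        ((η - Literature.MathematicalPhysics.QuantumManyBody.BoseGas.exciteProj N i η :
            MeasureTheory.Lp ℂ 2 (MeasureTheory.Measure.pi fun _ : Fin N × Fin 3 =>
              (AddCircle.haarAddCircle : MeasureTheory.Measure UnitAddCircle))) : UnitAddTorus (Fin N × Fin 3) → ℂ) t = 0 →
          ∀ᵐ c ∂(MeasureTheory.Measure.pi fun _ : Fin 3 => (AddCircle.haarAddCircle : MeasureTheory.Measure UnitAddCircle)),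
            (η : UnitAddTorus (Fin N × Fin 3) → ℂ)
              (t + Literature.MathematicalPhysics.QuantumManyBody.BoseGas.slotShift i c) = 0 := by
  intro N i η habs
  filter_upwards [coeFn_sub_exciteProj_ae_eq_slotAvg i η, ae_slotAvg_eq_zero_imp i habs] with t h1 h2 h0
  rw [h1] at h0
  exact h2 h0

end Summit.AtomisticToContinuum.BoseEinsteinCondensation.Cruxes.RewardChordBound.Birth

end
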